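import Summits.QuantumFields.BalabanUV.T4Continuum.Support.NE9ChartFaceOperator
import Summits.QuantumFields.BalabanUV.T4Continuum.Support.SubstrateTransporterSpeciesHolo

/-!
# NE9ChartFaceOperatorHolo — the NE9 chart face, operator-datum half, HOLOMORPHY WIRING: the chart-level raw kernel of record is
# ℂ-differentiable ENTRYWISE along the tower pair chart on every chart ball inside the regular set and the cut-off radius — the
# covariance species by the substrate's S-HOLO-AN (p221143), the four letter species under DISPLAYED letter holomorphy
# (cell `pub-balaban`, T4-DAG §2 node U3 ∕ §6 NE9; BINDER row NE9 OWNER lineage `b2b-balaban-t4-ne9-p1`, generation 31; follower of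
# `NE9ChartFaceOperator` (p221235) on `SubstrateTransporterSpeciesHolo` (p221143); substrate MAP v0.5∕v0.6 §O1 «D-8 RULED» (4)–(5))

HONEST FRAMING (T4-DAG PAGE 1).  Rung (B)+1 of the FINITE-VOLUME T⁴ programme — NOT infinite volume, NOT a mass gap, NOT the
Clay problem.  NE9 (`T4OutputRate.NE9` ∧ `FadingMemory`) is a cell NEW ESTIMATE, NOT PRINTED in [I] = [Balaban1987RG1] (CMP **109**),
[II] = [Balaban1988RG2Cluster] (CMP **116**), [B9] = [Balaban1985BackgroundPropagators] (CMP **99**), and NOT PROVED for Bałaban's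
E^{(j)} («NE9 ⇐ the named binders»; 0∕18 leaves instantiated on Bałaban's objects; spine PROVED 0∕9).  HONEST DEPENDENCY (cell
line, verbatim): continuum YM on T⁴ ⇐ BetaPertH ∧ nine spine estimates (0/9 proved); BetaPertH ⇐ (D1) ∧ (D4) ∧ CAP+tail; G-an2-4
gates asym, D1 and NE2/3/4.  `FlowStep.BetaPertH`, (B), (B^μ) do not occur.  Calculus bookkeeping only (no estimate, no `def`);
quotations for TYPES only (ABSOLUTE RULE); nothing of Bałaban's asserted.  0 sorry.

WHY THIS FILE.  NE9's END of record (p216114) reads the old terms on the balls `ball (0 : E) (R X)` of the chart and needs its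
`act` slot analytic there (through the instancer's M-rows); the operator datum of that slot is `NE9ChartFaceOperator.oRecChart S
(rawTKernel …) (towerPairChart P R⁰ ρ)` (p221235), assembled from the chart-level raw kernel `rawTKernel … g RS k e` of the substrate's
two-sided record (p220490).  The substrate's S-HOLO-AN (`SubstrateTransporterSpeciesHolo`, p221143) proves the COVARIANCE species
`covAtT … (expChartT R⁰ A) (expChartInvT R⁰ A) k t b b′` ℂ-differentiable in `A` on the REGULAR SET `regularSet … R⁰` (open, a ball
around `0` inside it as soon as the centre is regular — `exists_ball_subset_regularSet`, `zero_mem_regularSet_towerDataOf`); the four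
LETTER species (`dk`, `gc`, `pQ`, `pR` — NE5's displayed calibration letters, MAP §O1 O-8) are PARAMETERS whose holomorphy along the
chart is a DISPLAYED hypothesis here (print TYPE: [B9] Thm 3.4 p. 400 «the operators … extend to configurations U′U … as analytic
functions of A» for the kernel letters; [II] Lemma 2 (1.41)–(1.43) p. 11 for the potential letters).  THIS FILE wires the five cases:
* §1 bridges to p221143's tower chart: `towerExpChart = expChartT`, `towerExpChartInv = expChartInvT` (`rfl`); inside the cut-off radius
  the pair chart IS `(expChartT, expChartInvT)` (`towerPairChart_eq_of_norm_le`, `towerPairChart_eqOn_ball`);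
* §2 the five entry cases of `rawTKernel` (`rfl` lemmas) and **`differentiableOn_rawTKernel_expChartT`**: on any `S₀ ⊆ regularSet R⁰`,
  every entry of the chart-level raw kernel along `(expChartT R⁰ ·, expChartInvT R⁰ ·)` is `DifferentiableOn ℂ … S₀` — covariance
  entries by p221143 `differentiableOn_covAtT_expChart`, letter entries by the displayed hypotheses;
* §3 **`differentiableOn_rawTKernel_towerPairChart`**: the same along the CUT-OFF chart `towerPairChart R⁰ ρ` on every ball `ball 0 ρ₀`
  with `ρ₀ ≤ ρ` and `ball 0 ρ₀ ⊆ regularSet R⁰` (`DifferentiableOn.congr` through §1) — the form NE9's `analyticClass` balls ask;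
* §4 **`exists_ball_differentiableOn_rawTKernel`**: at a regular centre (`0 ∈ regularSet R⁰`; for the centre of record `towerDataOf U`
  this is p221143 `zero_mem_regularSet_towerDataOf` from the invertibility of `deltaQOf` at the block-averaged backgrounds — displayed ∕
  p3's `isUnit_det_deltaQOf_of_regular`) there is `ρ₀ > 0` such that for every cut-off radius `ρ ≥ ρ₀` all entries are differentiable
  on `ball 0 ρ₀`, given the letters' holomorphy there.
NOT HERE: the quantitative radius (VECJ-H, p3: `holoRadius`∕`InHoloBall`∕`HoloRadiusCompat`); analyticity of the ASSEMBLED `OpDatum`-valued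
map `A ↦ oRecChart … A` and of NE5's activities in the datum (instancer M-rows ∕ NE5's (2.14)–(2.22) TYPE); the table half; the END
application.  DISGUISE TEST: `DifferentiableOn` algebra + case split on the five species constructors; no estimate; nothing of NE9.

References (TYPES ∕ loci only): [Balaban1985BackgroundPropagators] T. Bałaban, CMP **99** (1985) 389–434, Sect. B pp. 399–400, Thm 3.4
p. 400; [Balaban1988RG2Cluster] T. Bałaban, CMP **116** (1988) 1–22, Lemma 2 (1.41)–(1.43) p. 11, (2.14) p. 15; [Balaban1987RG1] T. Bałaban,
CMP **109** (1987) 249–301, (1.18) p. 263.  Summits-side NEW work (LEAN PLACEMENT RULE); imports `NE9ChartFaceOperator` (p221235) and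
`SubstrateTransporterSpeciesHolo` (p221143) BY NAME; modifies nothing.  Value = bookkeeping on the row's instantiation path, NOT summit progress.
-/

noncomputable section

open scoped BigOperators Matrix Matrix.Norms.L2Operator

namespace Summit.QuantumFields.BalabanUV.T4Continuum.NE9ChartFaceOperatorHolo

open Metric Set
open Literature.MathematicalPhysics.QuantumFieldTheory.Balaban1983to89
open Literature.MathematicalPhysics.QuantumFieldTheory.Balaban1983to89.B5Prop11Plancherel (Tor fine)
open Literature.MathematicalPhysics.QuantumFieldTheory.Balaban1983to89.B5G183RateUnitTower (lev)
open Summit.QuantumFields.BalabanUV.T4Continuum.CovariantBlockAveraging (ContourSystem)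
open Summit.QuantumFields.BalabanUV.T4Continuum.B13OpDatum (Species)
open Summit.QuantumFields.BalabanUV.T4Continuum.SubstrateBackgroundTransporters (unitMod)
open Summit.QuantumFields.BalabanUV.T4Continuum.SubstrateTransporterSpecies
open Summit.QuantumFields.BalabanUV.T4Continuum.SubstrateTransporterSpeciesHolo
open Summit.QuantumFields.BalabanUV.T4Continuum.NE9ChartFaceOperator

variable (P : Params) {o : Type} [Fintype o] [DecidableEq o]

/-! ## §1 Bridges to the substrate's tower chart (p221143) -/

/-- [folklore] The owner's levelwise chart IS the substrate's `expChartT` (same formula; `rfl`). -/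
theorem towerExpChart_eq_expChartT (R₀ A : TowerData P o) : towerExpChart P R₀ A = expChartT P R₀ A := rfl

/-- [folklore] … and `towerExpChartInv = expChartInvT` (`rfl`). -/
theorem towerExpChartInv_eq_expChartInvT (R₀ A : TowerData P o) : towerExpChartInv P R₀ A = expChartInvT P R₀ A := rfl

/-- [folklore] **INSIDE THE CUT-OFF RADIUS THE PAIR CHART IS THE SUBSTRATE'S TOWER CHART PAIR**: `‖A‖ ≤ ρ ⇒
towerPairChart R⁰ ρ A = (expChartT R⁰ A, expChartInvT R⁰ A)`. -/
theorem towerPairChart_eq_of_norm_le (R₀ : TowerData P o) {ρ : ℝ} {A : TowerData P o} (h : ‖A‖ ≤ ρ) :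
    towerPairChart P R₀ ρ A = (expChartT P R₀ A, expChartInvT P R₀ A) :=
  cutoff_of_le _ _ h

/-- [folklore] On every ball `ball 0 ρ₀` with `ρ₀ ≤ ρ` the cut-off pair chart agrees with the tower chart pair. -/
theorem towerPairChart_eqOn_ball (R₀ : TowerData P o) {ρ₀ ρ : ℝ} (h : ρ₀ ≤ ρ) :
    EqOn (towerPairChart P R₀ ρ) (fun A => (expChartT P R₀ A, expChartInvT P R₀ A)) (ball 0 ρ₀) := by
  intro A hA
  rw [mem_ball_zero_iff] at hA
  exact towerPairChart_eq_of_norm_le P R₀ (by linarith)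

/-! ## §2 The five entry cases of the chart-level raw kernel and its holomorphy along the tower chart -/

section Kernel

variable (c : ℂ) (a : ℝ) (s : ℕ → ℂ) (Γ : (k : ℕ) → ContourSystem P.d (lev P.L k) (unitMod P)) {T ι' Ω 𝒴 : Type}
  (dk : TowerData P o → TowerData P o → ℕ → T → ι' → ι' → ℂ)
  (gc : TowerData P o → TowerData P o → ℕ → T → ((Tor (unitMod P) × Fin P.d) × o) → ι' → ℂ)
  (pQ : ℝ → TowerData P o → TowerData P o → ℕ → Ω → 𝒴 → ((Tor (unitMod P) × Fin P.d) × o) → ((Tor (unitMod P) × Fin P.d) × o) → ℂ)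
  (pR : ℝ → TowerData P o → TowerData P o → ℕ → Ω → 𝒴 → ℂ)

/-- [folklore] Covariance entries of the chart-level raw kernel read `covAtT` (`rfl`). -/
theorem rawTKernel_cov (g : ℕ → ℝ) (RS : TowerData P o × TowerData P o) (k : ℕ) (t : T)
    (b b' : (Tor (unitMod P) × Fin P.d) × o) :
    rawTKernel P c a s Γ dk gc pQ pR g RS k (.cov t b b') = covAtT P c a s Γ RS.1 RS.2 k t b b' := rfl

/-- [folklore] `deltaKer` entries read the letter `dk` (`rfl`). -/
theorem rawTKernel_deltaKer (g : ℕ → ℝ) (RS : TowerData P o × TowerData P o) (k : ℕ) (t : T) (i j : ι') :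
    rawTKernel P c a s Γ dk gc pQ pR g RS k (.deltaKer t i j) = dk RS.1 RS.2 k t i j := rfl

/-- [folklore] `gammaConstituent` entries read the letter `gc` (`rfl`). -/
theorem rawTKernel_gammaConstituent (g : ℕ → ℝ) (RS : TowerData P o × TowerData P o) (k : ℕ) (t : T)
    (b : (Tor (unitMod P) × Fin P.d) × o) (i : ι') :
    rawTKernel P c a s Γ dk gc pQ pR g RS k (.gammaConstituent t b i) = gc RS.1 RS.2 k t b i := rfl

/-- [folklore] `potQ` entries read the letter `pQ` at the LAST coupling `g (k − 1)` (`rfl`). -/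
theorem rawTKernel_potQ (g : ℕ → ℝ) (RS : TowerData P o × TowerData P o) (k : ℕ) (x : Ω) (Y : 𝒴)
    (b b' : (Tor (unitMod P) × Fin P.d) × o) :
    rawTKernel P c a s Γ dk gc pQ pR g RS k (.potQ x Y b b') = pQ (g (k - 1)) RS.1 RS.2 k x Y b b' := rfl

/-- [folklore] `potR` entries read the letter `pR` at the last coupling (`rfl`). -/
theorem rawTKernel_potR (g : ℕ → ℝ) (RS : TowerData P o × TowerData P o) (k : ℕ) (x : Ω) (Y : 𝒴) :
    rawTKernel P c a s Γ dk gc pQ pR g RS k (.potR x Y) = pR (g (k - 1)) RS.1 RS.2 k x Y := rfl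

/-- **HOLOMORPHY OF THE CHART-LEVEL RAW KERNEL ALONG THE TOWER CHART (entrywise).**  On any `S₀ ⊆ regularSet R⁰`: covariance
entries by the substrate's S-HOLO-AN (`differentiableOn_covAtT_expChart`, p221143 — KERNEL); the four letter entries under the
DISPLAYED holomorphy of the letters along the chart (TYPE: [B9] Thm 3.4 p. 400 for the kernel letters, [II] Lemma 2 (1.41)–(1.43)
p. 11 for the potential letters — hypotheses `hdk hgc hpQ hpR`, nothing asserted).
[cite: Balaban1985BackgroundPropagators, Thm 3.4 p.400; Balaban1988RG2Cluster, Lemma 2 (1.41)-(1.43) p.11] -/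
theorem differentiableOn_rawTKernel_expChartT (R₀ : TowerData P o) {S₀ : Set (TowerData P o)}
    (hS₀ : S₀ ⊆ regularSet P c a Γ R₀) (g : ℕ → ℝ) (k : ℕ)
    (hdk : ∀ (t : T) (i j : ι'), DifferentiableOn ℂ (fun A => dk (expChartT P R₀ A) (expChartInvT P R₀ A) k t i j) S₀)
    (hgc : ∀ (t : T) (b : (Tor (unitMod P) × Fin P.d) × o) (i : ι'),
      DifferentiableOn ℂ (fun A => gc (expChartT P R₀ A) (expChartInvT P R₀ A) k t b i) S₀)
    (hpQ : ∀ (x : Ω) (Y : 𝒴) (b b' : (Tor (unitMod P) × Fin P.d) × o),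
      DifferentiableOn ℂ (fun A => pQ (g (k - 1)) (expChartT P R₀ A) (expChartInvT P R₀ A) k x Y b b') S₀)
    (hpR : ∀ (x : Ω) (Y : 𝒴), DifferentiableOn ℂ (fun A => pR (g (k - 1)) (expChartT P R₀ A) (expChartInvT P R₀ A) k x Y) S₀)
    (e : Species T ((Tor (unitMod P) × Fin P.d) × o) ι' Ω 𝒴) :
    DifferentiableOn ℂ (fun A => rawTKernel P c a s Γ dk gc pQ pR g (expChartT P R₀ A, expChartInvT P R₀ A) k e) S₀ := by
  cases e with
  | cov t b b' =>
    simp only [rawTKernel_cov]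
    exact (differentiableOn_covAtT_expChart P c a Γ s R₀ k t b b').mono hS₀
  | deltaKer t i j => simp only [rawTKernel_deltaKer]; exact hdk t i j
  | gammaConstituent t b i => simp only [rawTKernel_gammaConstituent]; exact hgc t b i
  | potQ x Y b b' => simp only [rawTKernel_potQ]; exact hpQ x Y b b'
  | potR x Y => simp only [rawTKernel_potR]; exact hpR x Y

/-! ## §3 Along the CUT-OFF chart, on the balls NE9's analytic class asks -/

/-- **HOLOMORPHY ALONG THE CUT-OFF PAIR CHART ON A CHART BALL.**  For `ρ₀ ≤ ρ` (ball inside the cut-off radius) and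
`ball 0 ρ₀ ⊆ regularSet R⁰`, every entry of the chart-level raw kernel along `towerPairChart R⁰ ρ` is `DifferentiableOn ℂ … (ball 0 ρ₀)`
(§2 + `DifferentiableOn.congr` through §1) — the letter hypotheses as in §2, on the ball.
[cite: Balaban1985BackgroundPropagators, Thm 3.4 p.400; Balaban1987RG1, (1.18) p.263] -/
theorem differentiableOn_rawTKernel_towerPairChart (R₀ : TowerData P o) {ρ₀ ρ : ℝ} (hρ : ρ₀ ≤ ρ)
    (hball : ball (0 : TowerData P o) ρ₀ ⊆ regularSet P c a Γ R₀) (g : ℕ → ℝ) (k : ℕ)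
    (hdk : ∀ (t : T) (i j : ι'), DifferentiableOn ℂ (fun A => dk (expChartT P R₀ A) (expChartInvT P R₀ A) k t i j) (ball 0 ρ₀))
    (hgc : ∀ (t : T) (b : (Tor (unitMod P) × Fin P.d) × o) (i : ι'),
      DifferentiableOn ℂ (fun A => gc (expChartT P R₀ A) (expChartInvT P R₀ A) k t b i) (ball 0 ρ₀))
    (hpQ : ∀ (x : Ω) (Y : 𝒴) (b b' : (Tor (unitMod P) × Fin P.d) × o),
      DifferentiableOn ℂ (fun A => pQ (g (k - 1)) (expChartT P R₀ A) (expChartInvT P R₀ A) k x Y b b') (ball 0 ρ₀))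
    (hpR : ∀ (x : Ω) (Y : 𝒴),
      DifferentiableOn ℂ (fun A => pR (g (k - 1)) (expChartT P R₀ A) (expChartInvT P R₀ A) k x Y) (ball 0 ρ₀))
    (e : Species T ((Tor (unitMod P) × Fin P.d) × o) ι' Ω 𝒴) :
    DifferentiableOn ℂ (fun A => rawTKernel P c a s Γ dk gc pQ pR g (towerPairChart P R₀ ρ A) k e) (ball 0 ρ₀) :=
  (differentiableOn_rawTKernel_expChartT P c a s Γ dk gc pQ pR R₀ hball g k hdk hgc hpQ hpR e).congr fun A hA => by
    rw [towerPairChart_eqOn_ball P R₀ hρ hA]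

/-! ## §4 The ball exists at a regular centre -/

/-- **AT A REGULAR CENTRE THE CHART BALL EXISTS.**  If `0 ∈ regularSet R⁰` (for the centre of record `R⁰ = towerDataOf U`:
p221143 `zero_mem_regularSet_towerDataOf`, from the invertibility of `deltaQOf` at the block-averaged backgrounds — displayed ∕ p3),
there is `ρ₀ > 0` such that for EVERY cut-off radius `ρ ≥ ρ₀`, every history `g`, level `k` and entry `e`, the chart-level raw kernel
along `towerPairChart R⁰ ρ` is ℂ-differentiable on `ball 0 ρ₀` — given the letters' holomorphy there.  (The quantitative `ρ₀` is VECJ-H's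
`holoRadius`, p3; here it is the openness radius of p221143 `exists_ball_subset_regularSet`.)
[cite: Balaban1985BackgroundPropagators, Thm 3.4 p.400] -/
theorem exists_ball_differentiableOn_rawTKernel {R₀ : TowerData P o} (h0 : (0 : TowerData P o) ∈ regularSet P c a Γ R₀) :
    ∃ ρ₀ > 0, ∀ ρ, ρ₀ ≤ ρ → ∀ (g : ℕ → ℝ) (k : ℕ),
      (∀ (t : T) (i j : ι'), DifferentiableOn ℂ (fun A => dk (expChartT P R₀ A) (expChartInvT P R₀ A) k t i j) (ball 0 ρ₀)) →
      (∀ (t : T) (b : (Tor (unitMod P) × Fin P.d) × o) (i : ι'),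
        DifferentiableOn ℂ (fun A => gc (expChartT P R₀ A) (expChartInvT P R₀ A) k t b i) (ball 0 ρ₀)) →
      (∀ (x : Ω) (Y : 𝒴) (b b' : (Tor (unitMod P) × Fin P.d) × o),
        DifferentiableOn ℂ (fun A => pQ (g (k - 1)) (expChartT P R₀ A) (expChartInvT P R₀ A) k x Y b b') (ball 0 ρ₀)) →
      (∀ (x : Ω) (Y : 𝒴),
        DifferentiableOn ℂ (fun A => pR (g (k - 1)) (expChartT P R₀ A) (expChartInvT P R₀ A) k x Y) (ball 0 ρ₀)) →
      ∀ e : Species T ((Tor (unitMod P) × Fin P.d) × o) ι' Ω 𝒴,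
        DifferentiableOn ℂ (fun A => rawTKernel P c a s Γ dk gc pQ pR g (towerPairChart P R₀ ρ A) k e) (ball 0 ρ₀) := by
  obtain ⟨ρ₀, hρ₀, hball⟩ := exists_ball_subset_regularSet P c a Γ h0
  exact ⟨ρ₀, hρ₀, fun ρ hρ g k hdk hgc hpQ hpR e =>
    differentiableOn_rawTKernel_towerPairChart P c a s Γ dk gc pQ pR R₀ hρ hball g k hdk hgc hpQ hpR e⟩

end Kernel

end Summit.QuantumFields.BalabanUV.T4Continuum.NE9ChartFaceOperatorHolo

end
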